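import Summits.CriticalPhenomena.PercolationContinuityZ3.Theorems.PercNearOneGluingNoHeavyQuantBlobWalkBottomRoom
import HarnessLib

/-!
# QUANT lane R8 tool: the FAR exchange inequality for two-group block-combs with ROOM AT THE TOP
# (lead g11 N22 (3″)(ii): the upper group pays for the short fibres of the lower group) — no budget hypothesis

builds on p205010 (kernel theorem, internal audit signed; external expert review pending)

Support file (`--supports stmt-CriticalPhenomena-4575`), QUANT lane typer seat prim-quant-stmt (gen 14), rung R8 of
`run/shared/lean/prim/quant/LADDER.md`; typer target of the gen-11 lead (`prim-quant-lead-g11/LEAD-NOTES-G11.md` N22 (3″)(ii) "ROOM AT THE TOP",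
lane INBOX 2026-08-20T23:25Z (2)), in the generality of the walk calculus (arbitrary gates `≥ 1/2` inside each group, arbitrary sizes).  Companion of
`…QuantBlobWalkBottomRoom.lean` (same seat: `tail_gapRow`, `tail_row_lift`, `exchange_of_bottomRoom`).  Pure real algebra on the cdf recursion
`CB[a, p, m]` of `…QuantBlobWalk.lean`; no definitions (`local notation3` only), no sorries, standard axioms.

**Setting.**  A block-comb's blobs split into an UPPER group `k < m` (chain weights `≥ w₁ := w (m−1)`, gates `≥ 1/2` with `x ≤ w₁ · p k`, total
size `A`) and a LOWER group `m ≤ k < K` (chain weights `≥ w₂ := w (K−1)`, gates `≥ 1/2` with `x ≤ w₂ · p k`, total size `B`); terminal block `c`,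
layer `j`; `s₀` with `2j + 2 ≤ c + B + 2 s₀` (the lower group is `s₀` levels short of bottom room).  By the crossing identities the right side of the
exchange inequality is `≥ (w₁ − x)·P(X ≥ j+1) + (w₂ − x)·P(X ≤ j < X + Y)` (`X`, `Y` the open masses of the two groups); fibrewise in `X = s` the
lower group's gap row pays for `x·P(X + Y ≤ j − c, X = s)` as soon as `s ≥ s₀`, the short fibres `s < s₀` cost at most `x·P(X ≤ s₀ − 1)`, and the
upper group's gap row (`λ = s₀ ≤ η = j + 1`, `λ + η ≤ A`) bounds that by `(w₁ − x)·P(X ≥ j + 1)` — the credit of the fibres that crossed inside the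
upper group.  No budget `EN > 2j` is used (lead g11: "in these regimes FAR on two-height block-combs is STRUCTURAL").

* `Quant.BlobWalk.tail_lift₃` — a three-term linear fibre inequality in the tail cdf and the trivial cdf lifts through the head blobs
  (`BlobWalk.CB_head`; generalises `tail_row_lift`).
* `Quant.BlobWalk.topRoom_fibre` — the fibre inequality `CB[n](j − c − s) ≤ θ·(CB[0](j − s) − CB[n](j − s)) + CB[0](s₀ − 1 − s)` (`s ≥ 0`) for a
  walk with gates `≥ p₀ ≥ 1/2`, `θ = (1 − p₀)/p₀`, `2j + 2 ≤ c + Σ b + 2 s₀` (`tail_gapRow` at the shifted layer `j − s₀`).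
* `Quant.BlobWalk.exchange_of_topRoom` — **the exchange inequality, hence FAR at layer `j`, for every two-group block-comb as above with
  `A ≥ j + 1 + s₀` — NO budget hypothesis.**  Tree side: `Quant.farTree_blockComb_of_topRoom` (`…QuantFarTreeBlockCombTopRoom.lean`).
Exact re-check: `run/shared/lean/prim/quant/prim-quant-stmt-g14/code/check_top_room.py` (3 000 random rational two-group block-combs in the
regime, 0 violations).  RELATION TO THE LEAD'S FILES: simultaneously and independently lead g11 proved the TWO-HEIGHT exchange inequality in the
Finset-weight vocabulary of `…QuantIndepBlobFar.lean` (`Quant.IndepBlob.twoHeight_exchange_of_bottomRoom` / `_of_topRoom`,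
`…QuantTwoHeightFar.lean`, p240695); the present file is the `CB`/block-comb form the lead asked the typer for (lane INBOX 23:25Z (2): "the
block-comb wrapper via `blockComb_exchange_identity` and a two-height split of `CB`"), with arbitrarily many chain heights inside each group, and
it plugs directly into `Quant.farTree_blockComb_of_exchange`.  [this work]
-/

noncomputable section

namespace Summit.CriticalPhenomena.PercolationContinuityZ3.Theorems

namespace Quant

namespace BlobWalk

open Finset

/-- `CB[a, p, m] t` = probability that the open mass of the first `m` blobs (sizes `a`, gates `p`) is `≤ t` (the recursion of
`…QuantBlobWalk.lean`, verbatim). -/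
local notation3 "CB[" a ", " p ", " m "]" =>
  (Nat.rec (motive := fun _ => ℤ → ℝ) (fun t => if (0 : ℤ) ≤ t then (1 : ℝ) else 0)
    (fun n f t => (p : ℕ → ℝ) n * f (t - ((a : ℕ → ℕ) n : ℤ)) + (1 - (p : ℕ → ℝ) n) * f t) (m : ℕ))

/-! ### A three-term linear lift -/

/-- **Three-term tail lift.**  Let `(b, u)` be the tail of `(a, p)` after `m` blobs (`b i = a (m+i)`, `u i = p (m+i)`, `i < n`), gates in `[0,1]`.
If for every shift `s ≥ 0`
`α·CB[b,u,n](t₁ − s) + β·(CB[b,u,0](t₂ − s) − CB[b,u,n](t₂ − s)) + γ·CB[b,u,0](t₃ − s) ≤ 0`, then for every `d ≥ 0`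
`α·CB[a,p,m+n](t₁ − d) + β·(CB[a,p,m](t₂ − d) − CB[a,p,m+n](t₂ − d)) + γ·CB[a,p,m](t₃ − d) ≤ 0`
(the fibre variable `s` becomes the head mass; `CB_head` makes each head blob a convex combination of two shifts). [this work] -/
theorem tail_lift₃ (b : ℕ → ℕ) (u : ℕ → ℝ) (n : ℕ) (α β γ : ℝ) (t₁ t₂ t₃ : ℤ)
    (htail : ∀ s : ℤ, 0 ≤ s → α * CB[b, u, n] (t₁ - s) + β * (CB[b, u, 0] (t₂ - s) - CB[b, u, n] (t₂ - s)) +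
      γ * CB[b, u, 0] (t₃ - s) ≤ 0) :
    ∀ (m : ℕ) (a : ℕ → ℕ) (p : ℕ → ℝ), (∀ k, 0 ≤ p k ∧ p k ≤ 1) →
      (∀ i, i < n → b i = a (m + i)) → (∀ i, i < n → u i = p (m + i)) →
      ∀ d : ℤ, 0 ≤ d → α * CB[a, p, m + n] (t₁ - d) + β * (CB[a, p, m] (t₂ - d) - CB[a, p, m + n] (t₂ - d)) +
        γ * CB[a, p, m] (t₃ - d) ≤ 0 := by
  intro m
  induction m with
  | zero =>
    intro a p _ hb hu d hd
    have e : ∀ t : ℤ, CB[a, p, 0 + n] t = CB[b, u, n] t := fun t => by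
      rw [Nat.zero_add]
      exact (CB_congr₂ b a u p n (fun i hi => by rw [hb i hi, Nat.zero_add]) (fun i hi => by rw [hu i hi, Nat.zero_add]) t).symm
    have e0 : ∀ t : ℤ, CB[a, p, 0] t = CB[b, u, 0] t := fun t => by rw [CB_zero, CB_zero]
    rw [e, e, e0, e0]
    exact htail d hd
  | succ m ih =>
    intro a p hp hb hu d hd
    rw [show m + 1 + n = (m + n) + 1 from by omega, CB_head a p (m + n) (t₁ - d), CB_head a p (m + n) (t₂ - d),
      CB_head a p m (t₂ - d), CB_head a p m (t₃ - d)]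
    have hp' : ∀ k, 0 ≤ (fun i => p (i + 1)) k ∧ (fun i => p (i + 1)) k ≤ 1 := fun k => hp (k + 1)
    have hb' : ∀ i, i < n → b i = (fun i => a (i + 1)) (m + i) := fun i hi => by
      rw [hb i hi, show m + 1 + i = m + i + 1 from by omega]
    have hu' : ∀ i, i < n → u i = (fun i => p (i + 1)) (m + i) := fun i hi => by
      rw [hu i hi, show m + 1 + i = m + i + 1 from by omega]
    have h1 := ih (fun i => a (i + 1)) (fun i => p (i + 1)) hp' hb' hu' (d + (a 0 : ℤ))
      (by have := Int.natCast_nonneg (a 0); omega)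
    have h2 := ih (fun i => a (i + 1)) (fun i => p (i + 1)) hp' hb' hu' d hd
    have e1 : t₁ - d - (a 0 : ℤ) = t₁ - (d + (a 0 : ℤ)) := by ring
    have e2 : t₂ - d - (a 0 : ℤ) = t₂ - (d + (a 0 : ℤ)) := by ring
    have e3 : t₃ - d - (a 0 : ℤ) = t₃ - (d + (a 0 : ℤ)) := by ring
    rw [e1, e2, e3]
    have hp0 := hp 0
    have h1' := mul_nonpos_iff.2 (Or.inl ⟨hp0.1, h1⟩)
    have h2' := mul_nonpos_iff.2 (Or.inl ⟨sub_nonneg.2 hp0.2, h2⟩)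
    nlinarith [h1', h2']

/-! ### The fibre inequality of the lower group -/

/-- **Top-room fibre inequality.**  For a walk `(b, u)` of `n` blobs with gates `u k ≥ p₀ ≥ 1/2` (`k < n`), a terminal mass `c`, a layer `j` and a
shortfall `s₀` with `2j + 2 ≤ c + Σ_{k<n} b k + 2 s₀`, and `θ = (1 − p₀)/p₀`: for every fibre `s` (an integer; no sign needed),
`CB[b,u,n](j − c − s) ≤ θ·(CB[b,u,0](j − s) − CB[b,u,n](j − s)) + CB[b,u,0](s₀ − 1 − s)`
(short fibres `s < s₀` are charged `1`; from `s₀` on the gap row `tail_gapRow` at the layer `j − s₀` applies). [this work] -/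
theorem topRoom_fibre (b : ℕ → ℕ) (u : ℕ → ℝ) (hu : ∀ k, 0 ≤ u k ∧ u k ≤ 1) (n : ℕ) (p₀ : ℝ)
    (hhalf : 1 / 2 ≤ p₀) (hp₀1 : p₀ ≤ 1) (hp₀ : ∀ k, k < n → p₀ ≤ u k) (j c s₀ : ℕ)
    (hB : 2 * j + 2 ≤ c + ∑ k ∈ Finset.range n, b k + 2 * s₀) (s : ℤ) :
    CB[b, u, n] ((j : ℤ) - (c : ℤ) - s) ≤
      (1 - p₀) / p₀ * (CB[b, u, 0] ((j : ℤ) - s) - CB[b, u, n] ((j : ℤ) - s)) + CB[b, u, 0] ((s₀ : ℤ) - 1 - s) := by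
  have hp₀pos : 0 < p₀ := by linarith
  have hθ0 : 0 ≤ (1 - p₀) / p₀ := div_nonneg (by linarith) hp₀pos.le
  have hwin : 0 ≤ CB[b, u, 0] ((j : ℤ) - s) - CB[b, u, n] ((j : ℤ) - s) := by
    by_cases hjs : (0 : ℤ) ≤ (j : ℤ) - s
    · rw [CB_zero_of_nonneg b u hjs]; exact sub_nonneg.2 (CB_le_one b u hu n _)
    · push Not at hjs
      rw [CB_zero_of_neg b u hjs, CB_of_neg b u n _ hjs]; simp
  by_cases hshort : s ≤ (s₀ : ℤ) - 1
  · -- short fibre: charged one unit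
    rw [CB_zero_of_nonneg b u (by omega : (0 : ℤ) ≤ (s₀ : ℤ) - 1 - s)]
    have h1 : CB[b, u, n] ((j : ℤ) - (c : ℤ) - s) ≤ 1 := CB_le_one b u hu n _
    nlinarith [mul_nonneg hθ0 hwin]
  · -- `s ≥ s₀`: the gap row at the layer `j − s₀`, shift `s − s₀`
    push Not at hshort
    rw [CB_zero_of_neg b u (by omega : (s₀ : ℤ) - 1 - s < 0), add_zero]
    by_cases hjs : (j : ℤ) - s < 0
    · -- beyond the layer: both sides vanish
      rw [CB_of_neg b u n _ (by omega : (j : ℤ) - (c : ℤ) - s < 0)]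
      exact mul_nonneg hθ0 hwin
    · push Not at hjs
      rw [CB_zero_of_nonneg b u hjs]
      -- `j' = j − s₀ ≥ 0`, `s' = s − s₀ ≥ 0`, and `2j' + 2 ≤ c + Σ b`
      have hs₀j : s₀ ≤ j := by
        by_contra h
        push Not at h
        have : (j : ℤ) < s₀ := by exact_mod_cast h
        omega
      obtain ⟨j', hj'⟩ : ∃ j' : ℕ, j = j' + s₀ := ⟨j - s₀, by omega⟩
      have hB' : 2 * j' + 2 ≤ c + ∑ k ∈ Finset.range n, b k := by omega
      have key := tail_gapRow b u hu n p₀ hhalf hp₀1 hp₀ j' c hB' (s - s₀) (by omega)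
      have e1 : (j' : ℤ) - (c : ℤ) - (s - (s₀ : ℤ)) = (j : ℤ) - (c : ℤ) - s := by rw [hj']; push_cast; ring
      have e2 : (j' : ℤ) - (s - (s₀ : ℤ)) = (j : ℤ) - s := by rw [hj']; push_cast; ring
      rw [e1, e2] at key
      exact key

/-! ### The exchange inequality with room at the top -/

/-- **FAR exchange inequality with ROOM AT THE TOP (no budget hypothesis).**  Blobs `(a k, p k)_{k<K}` with gates in `[0,1]`, terminal block `c`,
layer `j`, chain weights `w`, least marginal `x ≥ 0`; an upper group `k < m` with `w (m−1) ≤ w k`, `p k ≥ 1/2`,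
`x ≤ w (m−1) · p k` and total size `A = Σ_{k<m} a k`; a lower group `m ≤ k < K` (`m < K`) with `w (K−1) ≤ w k` for all `k < K`, `p k ≥ 1/2`,
`x ≤ w (K−1) · p k` and total size `B`; a shortfall `s₀` with `2j + 2 ≤ c + B + 2 s₀`; and ROOM AT THE TOP: `j + 1 + s₀ ≤ A`.  Then
`x · CB[K](j − c) ≤ Σ_{k<K} (w k − x) · p k · (CB[k] j − CB[k](j − a k))` — FAR at layer `j` for the block-comb by
`Quant.blockComb_exchange_identity`. [this work] -/
theorem exchange_of_topRoom (a : ℕ → ℕ) (p : ℕ → ℝ) (hp : ∀ k, 0 ≤ p k ∧ p k ≤ 1) (K m : ℕ) (hmK : m < K) (j c s₀ : ℕ)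
    (x : ℝ) (w : ℕ → ℝ) (hx : 0 ≤ x)
    (hw₁ : ∀ k, k < m → w (m - 1) ≤ w k) (hw₂ : ∀ k, k < K → w (K - 1) ≤ w k)
    (hgrp₁ : ∀ k, k < m → 1 / 2 ≤ p k ∧ x ≤ w (m - 1) * p k)
    (hgrp₂ : ∀ k, m ≤ k → k < K → 1 / 2 ≤ p k ∧ x ≤ w (K - 1) * p k)
    (hB : 2 * j + 2 ≤ c + ∑ k ∈ Finset.Ico m K, a k + 2 * s₀)
    (hA : j + 1 + s₀ ≤ ∑ k ∈ Finset.range m, a k) :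
    x * CB[a, p, K] ((j : ℤ) - (c : ℤ)) ≤
      ∑ k ∈ Finset.range K, (w k - x) * p k * (CB[a, p, k] (j : ℤ) - CB[a, p, k] ((j : ℤ) - (a k : ℤ))) := by
  set W : ℕ → ℝ := fun k => CB[a, p, k] (j : ℤ) - CB[a, p, k] ((j : ℤ) - (a k : ℤ)) with hWdef
  have hW0 : ∀ k, 0 ≤ W k := fun k => window_nonneg a p hp k _
  have hj0 : (0 : ℤ) ≤ (j : ℤ) := Int.natCast_nonneg j
  have hcrossK : ∑ k ∈ Finset.range K, p k * W k = 1 - CB[a, p, K] (j : ℤ) := by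
    have := CB_cross a p K (j : ℤ); rw [CB_zero_of_nonneg a p hj0] at this; rw [this]
  have hcrossm : ∑ k ∈ Finset.range m, p k * W k = 1 - CB[a, p, m] (j : ℤ) := by
    have := CB_cross a p m (j : ℤ); rw [CB_zero_of_nonneg a p hj0] at this; rw [this]
  have hmK' : m ≤ K := hmK.le
  have hm1 : 1 ≤ m := by
    by_contra h
    push Not at h
    have : m = 0 := by omega
    subst this
    rw [Finset.sum_range_zero] at hA
    omega
  -- the two group sums of `p k · W k`
  have hsplit : ∀ f : ℕ → ℝ, ∑ k ∈ Finset.range K, f k = ∑ k ∈ Finset.range m, f k + ∑ k ∈ Finset.Ico m K, f k := by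
    intro f
    rw [Finset.range_eq_Ico, Finset.range_eq_Ico]
    exact (Finset.sum_Ico_consecutive f (Nat.zero_le m) hmK').symm
  have hS₂ : ∑ k ∈ Finset.Ico m K, p k * W k = CB[a, p, m] (j : ℤ) - CB[a, p, K] (j : ℤ) := by
    have := hsplit (fun k => p k * W k)
    rw [hcrossK, hcrossm] at this
    linarith
  have hS₂0 : 0 ≤ CB[a, p, m] (j : ℤ) - CB[a, p, K] (j : ℤ) := by
    rw [← hS₂]; exact Finset.sum_nonneg fun k _ => mul_nonneg (hp k).1 (hW0 k)
  -- RHS ≥ (w₁ − x)(1 − CB[m] j) + (w₂ − x)(CB[m] j − CB[K] j)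
  set w₁ := w (m - 1) with hw₁def
  set w₂ := w (K - 1) with hw₂def
  have hRHS : (w₁ - x) * (1 - CB[a, p, m] (j : ℤ)) + (w₂ - x) * (CB[a, p, m] (j : ℤ) - CB[a, p, K] (j : ℤ)) ≤
      ∑ k ∈ Finset.range K, (w k - x) * p k * W k := by
    rw [← hcrossm, ← hS₂, Finset.mul_sum, Finset.mul_sum, hsplit (fun k => (w k - x) * p k * W k)]
    refine add_le_add (Finset.sum_le_sum fun k hk => ?_) (Finset.sum_le_sum fun k hk => ?_)
    · have hkm := Finset.mem_range.1 hk
      have hpw : 0 ≤ p k * W k := mul_nonneg (hp k).1 (hW0 k)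
      calc (w₁ - x) * (p k * W k) ≤ (w k - x) * (p k * W k) := mul_le_mul_of_nonneg_right (by linarith [hw₁ k hkm]) hpw
        _ = (w k - x) * p k * W k := by ring
    · have hkK : k < K := (Finset.mem_Ico.1 hk).2
      have hpw : 0 ≤ p k * W k := mul_nonneg (hp k).1 (hW0 k)
      calc (w₂ - x) * (p k * W k) ≤ (w k - x) * (p k * W k) := mul_le_mul_of_nonneg_right (by linarith [hw₂ k hkK]) hpw
        _ = (w k - x) * p k * W k := by ring
  -- minimal gates of the two groups
  obtain ⟨k₁, hk₁, hmin₁⟩ := Finset.exists_min_image (Finset.range m) p ⟨0, Finset.mem_range.2 (by omega)⟩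
  have hk₁m : k₁ < m := Finset.mem_range.1 hk₁
  obtain ⟨k₂, hk₂, hmin₂⟩ := Finset.exists_min_image (Finset.Ico m K) p ⟨m, Finset.mem_Ico.2 ⟨le_rfl, hmK⟩⟩
  rw [Finset.mem_Ico] at hk₂
  set p₁ : ℝ := p k₁ with hp₁def
  set p₂ : ℝ := p k₂ with hp₂def
  have hhalf₁ : 1 / 2 ≤ p₁ := (hgrp₁ k₁ hk₁m).1
  have hxp₁ : x ≤ w₁ * p₁ := (hgrp₁ k₁ hk₁m).2
  have hp₁1 : p₁ ≤ 1 := (hp k₁).2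
  have hp₁pos : 0 < p₁ := by linarith
  have hhalf₂ : 1 / 2 ≤ p₂ := (hgrp₂ k₂ hk₂.1 hk₂.2).1
  have hxp₂ : x ≤ w₂ * p₂ := (hgrp₂ k₂ hk₂.1 hk₂.2).2
  have hp₂1 : p₂ ≤ 1 := (hp k₂).2
  have hp₂pos : 0 < p₂ := by linarith
  -- cap the shortfall at `j + 1`
  set s₁ : ℕ := min s₀ (j + 1) with hs₁def
  have hs₁le : s₁ ≤ j + 1 := min_le_right _ _
  have hs₁B : 2 * j + 2 ≤ c + ∑ k ∈ Finset.Ico m K, a k + 2 * s₁ := by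
    rcases le_total s₀ (j + 1) with h | h
    · rw [hs₁def, min_eq_left h]; exact hB
    · rw [hs₁def, min_eq_right h]; omega
  have hs₁A : j + 1 + s₁ ≤ ∑ k ∈ Finset.range m, a k := (by omega : j + 1 + s₁ ≤ j + 1 + s₀).trans hA
  -- (1) the lower group: lifted fibre inequality `CB[K](j−c) ≤ θ₂ (CB[m] j − CB[K] j) + CB[m](s₁ − 1)`
  set n : ℕ := K - m with hn
  set b : ℕ → ℕ := fun i => a (m + i) with hb
  set u : ℕ → ℝ := fun i => p (m + i) with hu
  have hu01 : ∀ k, 0 ≤ u k ∧ u k ≤ 1 := fun k => hp (m + k)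
  have hp₂u : ∀ i, i < n → p₂ ≤ u i := fun i hi => hmin₂ (m + i) (Finset.mem_Ico.2 ⟨by omega, by omega⟩)
  have hBn : 2 * j + 2 ≤ c + ∑ k ∈ Finset.range n, b k + 2 * s₁ := by
    have : ∑ k ∈ Finset.Ico m K, a k = ∑ k ∈ Finset.range n, b k := by rw [Finset.sum_Ico_eq_sum_range]
    rwa [this] at hs₁B
  have hfib : ∀ s : ℤ, 0 ≤ s → 1 * CB[b, u, n] ((j : ℤ) - (c : ℤ) - s) +
      (-((1 - p₂) / p₂)) * (CB[b, u, 0] ((j : ℤ) - s) - CB[b, u, n] ((j : ℤ) - s)) +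
        (-1) * CB[b, u, 0] (((s₁ : ℤ) - 1) - s) ≤ 0 := by
    intro s _
    have := topRoom_fibre b u hu01 n p₂ hhalf₂ hp₂1 hp₂u j c s₁ hBn s
    have e : (s₁ : ℤ) - 1 - s = ((s₁ : ℤ) - 1) - s := by ring
    rw [e] at this
    linarith
  have hlift := tail_lift₃ b u n 1 (-((1 - p₂) / p₂)) (-1) ((j : ℤ) - (c : ℤ)) (j : ℤ) ((s₁ : ℤ) - 1) hfib m a p hp
    (fun i _ => rfl) (fun i _ => rfl) 0 le_rfl
  rw [sub_zero, sub_zero, sub_zero, show m + n = K from by omega] at hlift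
  -- (2) the upper group: `CB[m](s₁ − 1) ≤ θ₁ (1 − CB[m] j)` (`tail_gapRow` for the prefix walk, terminal `j + 1 − s₁`)
  have hA' : 2 * j + 2 ≤ (j + 1 - s₁) + ∑ k ∈ Finset.range m, a k := by omega
  have hup := tail_gapRow a p hp m p₁ hhalf₁ hp₁1 (fun k hk => hmin₁ k (Finset.mem_range.2 hk)) j (j + 1 - s₁) hA' 0 le_rfl
  have e3 : (j : ℤ) - ((j + 1 - s₁ : ℕ) : ℤ) - 0 = (s₁ : ℤ) - 1 := by push_cast [Nat.cast_sub hs₁le]; ring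
  rw [e3, sub_zero] at hup
  -- (3) assemble
  have h1m : 0 ≤ 1 - CB[a, p, m] (j : ℤ) := sub_nonneg.2 (CB_le_one a p hp m _)
  have hxθ₁ : x * ((1 - p₁) / p₁) ≤ w₁ - x := by
    rw [mul_div_assoc', div_le_iff₀ hp₁pos]; nlinarith
  have hxθ₂ : x * ((1 - p₂) / p₂) ≤ w₂ - x := by
    rw [mul_div_assoc', div_le_iff₀ hp₂pos]; nlinarith
  have hCm0 : 0 ≤ CB[a, p, m] ((s₁ : ℤ) - 1) := CB_nonneg a p hp m _
  calc x * CB[a, p, K] ((j : ℤ) - (c : ℤ))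
      ≤ x * ((1 - p₂) / p₂ * (CB[a, p, m] (j : ℤ) - CB[a, p, K] (j : ℤ)) + CB[a, p, m] ((s₁ : ℤ) - 1)) :=
        mul_le_mul_of_nonneg_left (by linarith) hx
    _ = x * ((1 - p₂) / p₂) * (CB[a, p, m] (j : ℤ) - CB[a, p, K] (j : ℤ)) + x * CB[a, p, m] ((s₁ : ℤ) - 1) := by ring
    _ ≤ (w₂ - x) * (CB[a, p, m] (j : ℤ) - CB[a, p, K] (j : ℤ)) + x * ((1 - p₁) / p₁ * (1 - CB[a, p, m] (j : ℤ))) :=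
        add_le_add (mul_le_mul_of_nonneg_right hxθ₂ hS₂0) (mul_le_mul_of_nonneg_left hup hx)
    _ = (w₂ - x) * (CB[a, p, m] (j : ℤ) - CB[a, p, K] (j : ℤ)) + x * ((1 - p₁) / p₁) * (1 - CB[a, p, m] (j : ℤ)) := by ring
    _ ≤ (w₂ - x) * (CB[a, p, m] (j : ℤ) - CB[a, p, K] (j : ℤ)) + (w₁ - x) * (1 - CB[a, p, m] (j : ℤ)) :=
        add_le_add le_rfl (mul_le_mul_of_nonneg_right hxθ₁ h1m)
    _ ≤ ∑ k ∈ Finset.range K, (w k - x) * p k * W k := by linarith [hRHS]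

end BlobWalk

end Quant

end Summit.CriticalPhenomena.PercolationContinuityZ3.Theorems

end
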